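import Literature.NumberTheory.EllipticCurves.DeligneSerreProp27WeightOneDescentProofs
import Literature.NumberTheory.EllipticCurves.ModularSymbolsLattice
import HarnessLib

/-!
# The Eichler–Shimura period lattice of `S₂(Γ₁(N))` spans the dual space over `ℝ`
# (weight two, by the maximum principle), and `prop27_eigenvalues` from the rank half in weight two

`EichlerShimuraPeriodsGamma1RealSpanProofs` proves that the period lattice `periodLatticeK1 n` of
`S_{n+2}(Γ₁(N))` spans the dual space over `ℝ` for the weights `n + 2 ≥ 7` (twisted `L`-values).
This file proves the same spanning statement in **weight two** (`n = 0`) for every level `N`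
(`periodLatticeK1_zero_span_real_eq_top`), by porting the maximum-principle argument of
`ModularSymbolsLattice` (`eq_zero_of_im_cuspSymbol_div_eq_zero`, level `Γ₀(N)`) to `Γ₁(N)`:

* `cuspTranslate1`, `eq_zero_of_im_period_div_eq_zero_gamma1`: **a weight-`2` cusp form on
  `Γ₁(N)` all of whose periods `V_f(γτ) - V_f(τ)`, `γ ∈ Γ₁(N)` (`V_f = 2πi∫_{i∞}^τ f`, the
  vertical-ray integral of `ModularSymbolsProofs`), lie on one real line `uℝ` is zero** — with
  `G = exp(iV_f/u)`, `|G|` is `Γ₁(N)`-invariant; seen from the finitely many cusps `g_i∞`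
  (`Γ₁(N)` has finite index, Mathlib `instFiniteIndexGamma1`) `G ∘ g_i` is an `N`-periodic
  bounded holomorphic function, i.e. a holomorphic function of `q_N` on the unit disc; moving points
  into the standard fundamental domain and applying the maximum modulus principle
  (`exists_eqOn_const_of_norm_le_norm`) makes one of them constant, whence `f ∣[2] g_i = 0`,
  `f = 0` (the injectivity of the real Eichler–Shimura map `S₂(Γ₁(N)) → H¹(Γ₁(N), ℝ)`,
  Shimura 1971, §8.2).
* `periodFn1_zero_eq`: in weight two the period cocycle of `EichlerShimuraPeriodsGamma1` is
  `c_f(γ) = (i/2π)(V_{f|γ}(i) - V_f(γi))`; hence `eq_zero_of_isRePeriodVanishing_zero` and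
  **`periodLatticeK1_zero_span_real_eq_top`** (reflexivity of the finite-dimensional `S₂`), and the
  glue `heckeStableRealLatticeOfGeneratorsZero` (`HeckeStableRealLattice N 2` from `2 dim_ℂ S₂`
  generators of `periodLatticeK1 0`, as `heckeStableRealLatticeOfGenerators` in weights `≥ 7`).
* **`prop27_eigenvalues_of_forall_periodLatticeK1_zero_eq_span_generators`**: with
  `DeligneSerreProp27WeightOneDescentProofs`, Deligne–Serre's Prop. 2.7 (2.7.3)
  (`DeligneSerre1974.prop27_eigenvalues`, every weight) follows from the RANK half of weight-two
  Eichler–Shimura for `Γ₁(M)`, `8 ∣ M`: `periodLatticeK1 0` is the `ℤ`-span of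
  `2 dim_ℂ S₂(Γ₁(M))` functionals (Manin's presentation of `H₁(X₁(M), cusps; ℤ)` and
  `dim S₂(Γ₁(M)) = g(X₁(M))`, the `Γ₁` analogue of the discharged `periodHomology_eq_span_basis`).

Everything is proved; no named facts.

## References

* G. Shimura, *Introduction to the arithmetic theory of automorphic functions* (1971), §8.2,
  Thm. 8.4, (3.5.20).
* J. E. Cremona, *Algorithms for modular elliptic curves*, 2nd ed. (1997), (2.1.1)–(2.1.2), §2.10.
* G. Wiese, *Computational arithmetic of modular forms*, arXiv:1809.04645, Thm. 6.15, Rem. 6.16.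
-/

noncomputable section

open scoped MatrixGroups ModularForm Topology Manifold

open CongruenceSubgroup Complex MeasureTheory Set Filter Function
open UpperHalfPlane hiding I

namespace Literature.NumberTheory.EllipticCurves.ModularForms

open Metric

/-! ### The Eichler integral of a weight-two form on `Γ₁(N)` seen from another cusp -/

section CuspTranslate

variable {N : ℕ} [NeZero N] (f : CuspForm (Gamma1 N) 2) (g : SL(2, ℤ))

/-- The Eichler integral seen from the cusp `g∞`: the function
`z ↦ V_{f|g}(z) + (V_f(g·i) - V_{f|g}(i))` on `ℂ`, which is `N`-periodic and equals
`V_f(gz)` for `im z > 0` (`cuspTranslate1_eq`) (level-`Γ₁(N)` copy of `cuspTranslate`).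
[folklore] -/
def cuspTranslate1 (z : ℂ) : ℂ :=
  verticalIntegral (⇑f ∣[(2 : ℤ)] g) (ofComplex z) +
    (verticalIntegral ⇑f (g • UpperHalfPlane.I) -
      verticalIntegral (⇑f ∣[(2 : ℤ)] g) UpperHalfPlane.I)

/-- `cuspTranslate1 f g z = V_f(gz)` on the upper half-plane (`verticalIntegral_smul_sub_eq`).
[folklore] -/
theorem cuspTranslate1_eq (z : ℂ) :
    cuspTranslate1 f g z = verticalIntegral ⇑f (g • ofComplex z) := by
  have := verticalIntegral_smul_sub_eq g (isCuspFunction_one_gamma1 f)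
    (isCuspFunction_slash_gamma1 f g) (ofComplex z) UpperHalfPlane.I
  rw [cuspTranslate1]
  linear_combination -this

omit [NeZero N] in
/-- `cuspTranslate1 f g` is `N`-periodic (`f ∣[2] g` is `Tᴺ`-invariant). [folklore] -/
theorem periodic_cuspTranslate1 : Periodic (cuspTranslate1 f g) (N : ℝ) := by
  intro z
  by_cases hz : 0 < z.im
  · simp only [cuspTranslate1]
    rw [verticalIntegral_ofComplex_add (periodic_slash_gamma1 f g) hz]
  · have hz' : (z + ((N : ℝ) : ℂ)).im ≤ 0 := by simpa using hz
    simp only [cuspTranslate1, ofComplex_apply_eq_of_im_nonpos hz' (not_lt.mp hz)]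

/-- `d/dz cuspTranslate1 f g = 2πi (f ∣[2] g)` on the upper half-plane. [folklore] -/
theorem hasDerivAt_cuspTranslate1 {z : ℂ} (hz : 0 < z.im) :
    HasDerivAt (cuspTranslate1 f g) (2 * Real.pi * I * (⇑f ∣[(2 : ℤ)] g) (ofComplex z)) z := by
  change HasDerivAt (fun w ↦ verticalIntegral (⇑f ∣[(2 : ℤ)] g) (ofComplex w) + _) _ z
  exact ((isCuspFunction_slash_gamma1 f g).hasDerivAt_verticalIntegral hz).add_const _

/-- `cuspTranslate1 f g` is bounded on `{im z ≥ 1}`. [folklore] -/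
theorem exists_norm_cuspTranslate1_le :
    ∃ C : ℝ, ∀ z : ℂ, 1 ≤ z.im → ‖cuspTranslate1 f g z‖ ≤ C := by
  obtain ⟨C, hC⟩ := (isCuspFunction_slash_gamma1 f g).exists_norm_verticalIntegral_le one_pos
  refine ⟨C + ‖verticalIntegral ⇑f (g • UpperHalfPlane.I) -
      verticalIntegral (⇑f ∣[(2 : ℤ)] g) UpperHalfPlane.I‖, fun z hz ↦ ?_⟩
  have hz0 : 0 < z.im := by linarith
  have him : 1 ≤ (ofComplex z).im := by
    rw [ofComplex_apply_of_im_pos hz0]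
    exact hz
  exact (norm_add_le _ _).trans (add_le_add (hC _ him) le_rfl)

end CuspTranslate

/-! ### A weight-two cusp form on `Γ₁(N)` whose periods lie on a line vanishes -/

section Line

variable {N : ℕ} [NeZero N]

/-- **A weight-`2` cusp form on `Γ₁(N)` all of whose periods `V_f(γτ) - V_f(τ)` (`γ ∈ Γ₁(N)`)
lie on one real line `uℝ` through `0` is zero** (level-`Γ₁(N)` copy of
`eq_zero_of_im_cuspSymbol_div_eq_zero`): with `G = exp(iV_f/u)`, `|G|` is `Γ₁(N)`-invariant; seen
from each of the finitely many cusps `g_i∞`, `G ∘ g_i` is `N`-periodic and bounded, hence a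
holomorphic function `Φ_i` of `q_N` on the unit disc; every value of `|G|` is a value of some
`|Φ_j|` on the closed disc `|q_N| ≤ e^{-π/N}`, so by the maximum modulus principle some `Φ_i` is
constant, whence `f ∣[2] g_i = 0` and `f = 0`.  This is the injectivity of the real
Eichler–Shimura map `S₂(Γ₁(N)) → Hom(Γ₁(N), ℝ)`, `f ↦ (γ ↦ re((V_f(γτ) - V_f(τ)) ū))`
(Shimura 1971, §8.2).  The weight is a parameter `k = 2` so that forms of weight `0 + 2` can be fed
in. [cite: Shimura1971, §8.2] -/
theorem eq_zero_of_im_period_div_eq_zero_gamma1 {k : ℤ} (f : CuspForm (Gamma1 N) k) (hk : k = 2)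
    {u : ℂ} (hu : u ≠ 0)
    (hline : ∀ γ : SL(2, ℤ), γ ∈ Gamma1 N → ∀ τ : ℍ,
      ((verticalIntegral ⇑f (γ • τ) - verticalIntegral ⇑f τ) / u).im = 0) : f = 0 := by
  subst hk
  classical
  have hN : (0 : ℝ) < N := by exact_mod_cast Nat.pos_of_ne_zero (NeZero.ne N)
  -- coset representatives of `Γ₀(N)` in `SL(2, ℤ)`
  haveI : Nonempty (SL(2, ℤ) ⧸ Gamma1 N) := ⟨((1 : SL(2, ℤ)) : SL(2, ℤ) ⧸ Gamma1 N)⟩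
  set rep : SL(2, ℤ) ⧸ Gamma1 N → SL(2, ℤ) := fun i ↦ (Quotient.out i)⁻¹ with hrep
  -- `W i = G ∘ g_i` as an `N`-periodic function on `ℂ`, `Φ i` its cusp function
  set W : SL(2, ℤ) ⧸ Gamma1 N → ℂ → ℂ := fun i z ↦ cexp (I * cuspTranslate1 f (rep i) z / u)
    with hW
  set Φ : SL(2, ℤ) ⧸ Gamma1 N → ℂ → ℂ := fun i ↦ Periodic.cuspFunction N (W i) with hΦ
  -- `E = |G|`
  set E : ℍ → ℝ := fun τ ↦ ‖cexp (I * verticalIntegral ⇑f τ / u)‖ with hE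
  -- (a) periodicity
  have hWper : ∀ i, Periodic (W i) (N : ℝ) := fun i z ↦ by
    simp only [hW]
    rw [periodic_cuspTranslate1 f (rep i) z]
  -- (b) differentiability on the upper half-plane
  have hWd : ∀ i (z : ℂ), 0 < z.im → HasDerivAt (W i) (W i z *
      (I * (2 * Real.pi * I * (⇑f ∣[(2 : ℤ)] rep i) (ofComplex z)) / u)) z := by
    intro i z hz
    have := (((hasDerivAt_cuspTranslate1 f (rep i) hz).const_mul I).div_const u).cexp
    simpa only [hW, mul_div_assoc] using this
  have hWdiff : ∀ i (z : ℂ), 0 < z.im → DifferentiableAt ℂ (W i) z := fun i z hz ↦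
    (hWd i z hz).differentiableAt
  -- (c) boundedness high in the cusp
  have hWbd : ∀ i, ∃ A C : ℝ, ∀ z : ℂ, A ≤ z.im → ‖W i z‖ ≤ C := by
    intro i
    obtain ⟨C, hC⟩ := exists_norm_cuspTranslate1_le f (rep i)
    refine ⟨1, Real.exp (C / ‖u‖), fun z hz ↦ ?_⟩
    simp only [hW]
    rw [Complex.norm_exp]
    apply Real.exp_le_exp.mpr
    refine (Complex.re_le_norm _).trans ?_
    rw [norm_div, norm_mul, Complex.norm_I, one_mul]
    exact div_le_div_of_nonneg_right (hC z hz) (norm_nonneg u)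
  -- hence `Φ i` is holomorphic on the unit disc, with `Φ i (q_N z) = W i z`
  have hΦd : ∀ i, DifferentiableOn ℂ (Φ i) (ball 0 1) := fun i ↦
    differentiableOn_cuspFunction_ball_of_im_pos hN (hWper i) (hWdiff i) (hWbd i)
  have hΦq : ∀ i (z : ℂ), Φ i (Periodic.qParam N z) = W i z := fun i z ↦
    Periodic.eq_cuspFunction hN.ne' (hWper i) z
  -- (e) `|W i z| = E (g_i z)`
  have hWE : ∀ i (z : ℂ), 0 < z.im → ‖W i z‖ = E (rep i • ofComplex z) := fun i z hz ↦ by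
    simp only [hW, hE, cuspTranslate1_eq f (rep i) z]
  -- (f) `E` is `Γ₁(N)`-invariant
  have hEinv : ∀ (γ : Gamma1 N) (τ : ℍ), E ((γ : SL(2, ℤ)) • τ) = E τ := by
    intro γ τ
    set P : ℂ := verticalIntegral ⇑f ((γ : SL(2, ℤ)) • τ) - verticalIntegral ⇑f τ with hP
    have h1 : verticalIntegral ⇑f ((γ : SL(2, ℤ)) • τ) = verticalIntegral ⇑f τ + P := by
      rw [hP]
      ring
    simp only [hE, h1]
    rw [show I * (verticalIntegral ⇑f τ + P) / u =
        I * verticalIntegral ⇑f τ / u + I * (P / u) by ring, Complex.exp_add, norm_mul,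
      Complex.norm_exp (I * (P / u))]
    simp [Complex.mul_re]
    exact hline (γ : SL(2, ℤ)) γ.2 τ
  -- (g) every point of `ℍ` is `Γ₀(N)`-equivalent to some `g_i τ₀`, `τ₀ ∈ 𝒟`
  have hcov : ∀ τ : ℍ, ∃ i, ∃ τ₀ ∈ ModularGroup.fd, E τ = E (rep i • τ₀) := by
    intro τ
    obtain ⟨g, hg⟩ := ModularGroup.exists_smul_mem_fd τ
    obtain ⟨γ, hγ⟩ := QuotientGroup.mk_out_eq_mul (Gamma1 N) g
    refine ⟨QuotientGroup.mk g, g • τ, hg, ?_⟩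
    simp only [hrep]
    rw [hγ, mul_inv_rev, mul_smul, inv_smul_smul, ← Subgroup.coe_inv, hEinv]
  -- (h) on `𝒟`, `|q_N| ≤ r := e^{-π/N} < 1`
  set r : ℝ := Real.exp (-(Real.pi / N)) with hr
  have hr0 : 0 ≤ r := (Real.exp_pos _).le
  have hr1 : r < 1 := Real.exp_lt_one_iff.mpr (by
    have : 0 < Real.pi / N := by positivity
    linarith)
  have hqfd : ∀ τ₀ ∈ ModularGroup.fd, ‖Periodic.qParam N (τ₀ : ℂ)‖ ≤ r := by
    intro τ₀ hτ₀
    have h3 := ModularGroup.three_le_four_mul_im_sq_of_mem_fd hτ₀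
    have him : 1 / 2 ≤ τ₀.im := by nlinarith [τ₀.im_pos]
    rw [Periodic.norm_qParam, UpperHalfPlane.coe_im, hr]
    apply Real.exp_le_exp.mpr
    have hpos : 0 < Real.pi / N := by positivity
    rw [show -2 * Real.pi * τ₀.im / N = -(2 * τ₀.im * (Real.pi / N)) by ring]
    nlinarith
  -- the maximum-modulus lemma: some `Φ i` is constant
  obtain ⟨i, c, hc⟩ := exists_eqOn_const_of_norm_le_norm hΦd hr0 hr1 (by
    intro i q hq hq0
    have hq1 : ‖q‖ < 1 := by simpa using hq
    obtain ⟨z, hz, rfl⟩ := exists_qParam_eq_of_norm_lt_one hN hq0 hq1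
    obtain ⟨j, τ₀, hτ₀, hEq⟩ := hcov (rep i • ofComplex z)
    refine ⟨j, Periodic.qParam N (τ₀ : ℂ), by simpa using hqfd τ₀ hτ₀, ?_⟩
    rw [hΦq, hΦq, hWE i z hz, hEq, hWE j (τ₀ : ℂ) τ₀.im_pos, ofComplex_apply])
  -- so `W i` is constant on the upper half-plane
  have hWc : ∀ z : ℂ, 0 < z.im → W i z = c := fun z hz ↦ by
    rw [← hΦq i z]
    exact hc (by simpa using Periodic.norm_qParam_lt_one hN hz)
  -- hence `f ∣[2] g_i = 0`
  have hslash : ∀ z : ℂ, 0 < z.im → (⇑f ∣[(2 : ℤ)] rep i) (ofComplex z) = 0 := by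
    intro z hz
    have hd0 : HasDerivAt (W i) 0 z := by
      refine (hasDerivAt_const z c).congr_of_eventuallyEq ?_
      filter_upwards [isOpen_upperHalfPlaneSet.mem_nhds hz] with w hw
      exact hWc w hw
    have h0 := (hWd i z hz).unique hd0
    have hW0 : W i z ≠ 0 := Complex.exp_ne_zero _
    have hπ : (Real.pi : ℂ) ≠ 0 := by exact_mod_cast Real.pi_ne_zero
    simpa [hW0, hu, hπ, I_ne_zero, mul_eq_zero, div_eq_zero_iff] using h0
  -- and `f = 0`
  have hzero : ∀ τ : ℍ, f τ = 0 := by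
    intro τ
    have h1 := hslash (((rep i)⁻¹ • τ : ℍ) : ℂ) ((rep i)⁻¹ • τ).im_pos
    rw [ofComplex_apply, ModularForm.SL_slash_apply, smul_inv_smul, mul_eq_zero] at h1
    rcases h1 with h1 | h1
    · exact h1
    · exact absurd h1 (zpow_ne_zero _ (denom_ne_zero _ _))
  ext τ
  simpa using hzero τ

end Line

/-! ### Weight two: the period cocycle and the real span of `periodLatticeK1 0` -/

section WeightTwo

variable {N : ℕ} [NeZero N]

omit [NeZero N] in
/-- **The weight-two period cocycle**: for `n = 0`,
`periodFn1 0 f γ p = (i/2π) (V_{f|γ}(i) - V_f(γ i))` (independent of `p`). [folklore] -/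
theorem periodFn1_zero_eq (f : CuspForm (Gamma1 N) ((0 : ℕ) + 2)) (γ : SL(2, ℤ))
    (p : Fin 2 → ℂ) :
    periodFn1 0 f γ p = I / (2 * Real.pi) *
      (verticalIntegral (⇑f ∣[((0 : ℕ) + 2 : ℤ)] γ) UpperHalfPlane.I -
        verticalIntegral ⇑f (γ • UpperHalfPlane.I)) := by
  simp only [periodFn1, eichlerKernel, zero_add, Finset.sum_range_one, Nat.choose_self,
    Nat.cast_one, one_mul, powPrimitive_zero, pow_zero, Nat.sub_zero, mul_one, eichlerPrimitive_eq]
  ring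

/-- For `γ ∈ Γ₁(N)` the weight-two period `V_f(γτ) - V_f(τ)` does not depend on `τ`. [folklore] -/
theorem verticalIntegral_smul_sub_eq_of_mem_gamma1 (f : CuspForm (Gamma1 N) ((0 : ℕ) + 2))
    {γ : SL(2, ℤ)} (hγ : γ ∈ Gamma1 N) (τ : ℍ) :
    verticalIntegral ⇑f (γ • τ) - verticalIntegral ⇑f τ =
      verticalIntegral ⇑f (γ • UpperHalfPlane.I) - verticalIntegral ⇑f UpperHalfPlane.I := by
  have hinv : ⇑f ∣[(2 : ℤ)] γ = ⇑f := slash_eq_self_of_mem_gamma1 f hγ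
  have hψ : IsCuspFunction N (⇑f ∣[(2 : ℤ)] γ) := isCuspFunction_slash_gamma1 f γ
  have h := verticalIntegral_smul_sub_eq γ (isCuspFunction_one_gamma1 f) hψ τ UpperHalfPlane.I
  rwa [hinv] at h

/-- **In weight two, a form with purely imaginary period-lattice values vanishes**: if
`re φ(f) = 0` for all `φ ∈ periodLatticeK1 0` (`IsRePeriodVanishing 0 f`), then `f = 0` — the
weight-two case left open by `eq_zero_of_isRePeriodVanishing` (weights `≥ 7`), by the maximum
principle (`eq_zero_of_im_period_div_eq_zero_gamma1`). [cite: Shimura1971, Thm. 8.4] -/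
theorem eq_zero_of_isRePeriodVanishing_zero {f : CuspForm (Gamma1 N) ((0 : ℕ) + 2)}
    (hf : IsRePeriodVanishing 0 f) : f = 0 := by
  refine eq_zero_of_im_period_div_eq_zero_gamma1 f (by norm_num) one_ne_zero fun γ hγ τ ↦ ?_
  have hγ0 : γ ∈ Gamma0 N := Gamma1_in_Gamma0 N hγ
  have h0 := (isRePeriodVanishing_iff f).mp hf ⟨γ, hγ0⟩ 0
  rw [periodFunctionalK1_apply, show (((⟨γ, hγ0⟩ : Gamma0 N) : SL(2, ℤ))) = γ from rfl,
    periodFn1_zero_eq, slash_eq_self_of_mem_gamma1 f hγ] at h0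
  set D : ℂ := verticalIntegral ⇑f UpperHalfPlane.I - verticalIntegral ⇑f (γ • UpperHalfPlane.I)
    with hD
  have hre : (I / (2 * Real.pi) * D).re = -D.im / (2 * Real.pi) := by
    rw [show I / (2 * Real.pi) * D = D * I / ((2 * Real.pi : ℝ) : ℂ) by push_cast; ring,
      Complex.div_ofReal_re, Complex.mul_I_re]
  rw [hre] at h0
  have hπ : (2 * Real.pi : ℝ) ≠ 0 := by positivity
  have hDim : D.im = 0 := by
    have := div_eq_zero_iff.mp h0
    rcases this with h | h
    · exact neg_eq_zero.mp h
    · exact absurd h hπ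
  rw [div_one, verticalIntegral_smul_sub_eq_of_mem_gamma1 f hγ τ,
    show verticalIntegral ⇑f (γ • UpperHalfPlane.I) - verticalIntegral ⇑f UpperHalfPlane.I = -D by
      rw [hD]; ring, Complex.neg_im, hDim, neg_zero]

variable (N) in
/-- **The Eichler–Shimura period lattice of `S₂(Γ₁(N))` spans the dual space over `ℝ`** (weight
two; the weights `≥ 7` are `periodLatticeK1_span_real_eq_top`): a real-linear functional on `S^∨` is
`φ ↦ re φ(f)` for some `f` (reflexivity), and if it kills the period lattice then `f = 0`
(`eq_zero_of_isRePeriodVanishing_zero`) — one half of Shimura's (3.5.20) for `Γ' = Γ₁(N)`,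
`k = 2`. [cite: Shimura1971, Thm. 8.4 and (3.5.20)] -/
theorem periodLatticeK1_zero_span_real_eq_top :
    Submodule.span ℝ (periodLatticeK1 (N := N) 0 :
      Set (Module.Dual ℂ (CuspForm (Gamma1 N) ((0 : ℕ) + 2)))) = ⊤ := by
  by_contra htop
  obtain ⟨ℓ, hℓ, hker⟩ := Submodule.exists_le_ker_of_lt_top _ (lt_top_iff_ne_top.mpr htop)
  let ψ : Module.Dual ℂ (Module.Dual ℂ (CuspForm (Gamma1 N) ((0 : ℕ) + 2))) :=
    Module.Dual.extendRCLike ℓ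
  have hψ : ∀ φ, (ψ φ).re = ℓ φ := fun φ ↦ Module.Dual.re_extendRCLike_apply (𝕜 := ℂ) ℓ φ
  obtain ⟨f, hf⟩ := (Module.evalEquiv ℂ (CuspForm (Gamma1 N) ((0 : ℕ) + 2))).surjective ψ
  have hre : IsRePeriodVanishing 0 f := by
    intro φ hφ
    have h1 : ψ φ = φ f := by rw [← hf]; rfl
    rw [← h1, hψ]
    exact hker (Submodule.subset_span hφ)
  have h0 : f = 0 := eq_zero_of_isRePeriodVanishing_zero hre
  apply hℓ
  ext φ
  rw [← hψ, ← hf, h0, map_zero, LinearMap.zero_apply, Complex.zero_re, LinearMap.zero_apply]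

/-- **A full Hecke-stable lattice in weight two from `2 dim_ℂ S₂` generators of the period
lattice** (`HeckeStableRealLattice N (0 + 2)`; the weights `≥ 7` are
`heckeStableRealLatticeOfGenerators`): if `periodLatticeK1 0` is the `ℤ`-span of
`2 dim_ℂ S₂(Γ₁(N))` functionals — the rank half of weight-two Eichler–Shimura — then these are an
`ℝ`-basis of the dual space (they span by `periodLatticeK1_zero_span_real_eq_top`), with `ℤ`-span
stable under all `T_p^∨` and `⟨d⟩^∨` (`periodLatticeK1_fg_stable_separating`).
[cite: Shimura1971, (3.5.20) and Thm. 8.4] -/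
def heckeStableRealLatticeOfGeneratorsZero
    (g : Fin (2 * Module.finrank ℂ (CuspForm (Gamma1 N) ((0 : ℕ) + 2))) →
      Module.Dual ℂ (CuspForm (Gamma1 N) ((0 : ℕ) + 2)))
    (hg : (periodLatticeK1 (N := N) 0 :
        Set (Module.Dual ℂ (CuspForm (Gamma1 N) ((0 : ℕ) + 2)))) =
      Submodule.span ℤ (Set.range g)) :
    HeckeStableRealLattice N ((0 : ℕ) + 2) := by
  have hspan : ⊤ ≤ Submodule.span ℝ (Set.range g) := by
    rw [← periodLatticeK1_zero_span_real_eq_top N, Submodule.span_le, hg]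
    exact Submodule.span_le_restrictScalars ℤ ℝ _
  have hcard : Fintype.card (Fin (2 * Module.finrank ℂ (CuspForm (Gamma1 N) ((0 : ℕ) + 2)))) =
      Module.finrank ℝ (Module.Dual ℂ (CuspForm (Gamma1 N) ((0 : ℕ) + 2))) := by
    rw [Fintype.card_fin, finrank_real_of_complex, Subspace.dual_finrank_eq]
  have hli : LinearIndependent ℝ g :=
    linearIndependent_of_top_le_span_of_card_eq_finrank hspan hcard
  have hlat : ∀ φ, φ ∈ periodLatticeK1 (N := N) 0 ↔ φ ∈ Submodule.span ℤ (Set.range g) :=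
    fun φ ↦ by rw [← SetLike.mem_coe, hg, SetLike.mem_coe]
  refine ⟨_, Module.Basis.mk hli hspan, fun p hp i ↦ ?_, fun d i ↦ ?_⟩
  · rw [Module.Basis.coe_mk, ← hlat]
    exact (periodLatticeK1_fg_stable_separating N 0).2.1 p hp _
      ((hlat _).mpr (Submodule.subset_span (Set.mem_range_self i)))
  · rw [Module.Basis.coe_mk, ← hlat]
    exact (periodLatticeK1_fg_stable_separating N 0).2.2.1 _ _
      ((hlat _).mpr (Submodule.subset_span (Set.mem_range_self i)))

/-- **`prop27_eigenvalues` from the RANK half of weight-two Eichler–Shimura for `Γ₁(M)`,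
`8 ∣ M`**: if for every such `M` the period lattice `periodLatticeK1 0` of `S₂(Γ₁(M))` is the
`ℤ`-span of `2 dim_ℂ S₂(Γ₁(M))` functionals (Manin's presentation of the weight-two modular symbols
of `Γ₁(M)` with `dim S₂(Γ₁(M)) = g(X₁(M))`; the `Γ₁(M)` analogue of the discharged
`periodHomology_eq_span_fin_two_mul_finrank`), then Deligne–Serre's Prop. 2.7 (2.7.3) holds in
every weight, weight one included (`prop27_eigenvalues_of_forall_heckeStableRealLattice_two` of
`DeligneSerreProp27WeightOneDescentProofs`). [cite: Shimura1971, Thm. 8.4 and Prop. 8.6] -/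
theorem prop27_eigenvalues_of_forall_periodLatticeK1_zero_eq_span_generators
    (H : ∀ (M : ℕ) [NeZero M], 8 ∣ M →
      ∃ g : Fin (2 * Module.finrank ℂ (CuspForm (Gamma1 M) ((0 : ℕ) + 2))) →
        Module.Dual ℂ (CuspForm (Gamma1 M) ((0 : ℕ) + 2)),
        (periodLatticeK1 (N := M) 0 :
            Set (Module.Dual ℂ (CuspForm (Gamma1 M) ((0 : ℕ) + 2)))) =
          Submodule.span ℤ (Set.range g)) :
    DeligneSerre1974.prop27_eigenvalues :=
  prop27_eigenvalues_of_forall_heckeStableRealLattice_two fun M _ h8 ↦ by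
    obtain ⟨g, hg⟩ := H M h8
    have := heckeStableRealLatticeOfGeneratorsZero g hg
    simpa using (⟨this⟩ : Nonempty _)

end WeightTwo

end Literature.NumberTheory.EllipticCurves.ModularForms
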